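import Summits.BirchSwinnertonDyer.BirchSwinnertonDyer.Theorems.GenusKolyvaginAtTwoPowDvdShaCardAtTwoRTGenusIndexLaw
import HarnessLib

/-!
# Route `GenusKolyvaginAtTwo`, LINE 19 v4.2 (L⁺_T `PowDvdShaCardAtTwoPosT`, stmt-BirchSwinnertonDyer-23379, exhibition half of the
# declared residual Q4_T 23240 on `Δ(E) > 0`): registered stub K `stub_genusIndexLaw` — THE GENUS INDEX LAW ON `Δ > 0`,
# `ord₂ ρ = ord₂ C(Wd)`, PROVED MODULO the named fact `kolyvagin`

Seat `bsd-line-gk2-p2` g14 (cell `bsd-f1-sign2`), `--supports` (helper; closes nothing — CONDITIONAL on ONE displayed PRINT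
antecedent, D-0014).  THEOREMS ONLY (no definition, no new named fact, no `sorry`); BSD is not proved by any of this.  The `Δ > 0`
twin of `…GenusIndexLaw.lean` (LINE 18, `Δ < 0`, `ord₂ ρ = ord₂ C(Wd) − 1`): the only change is the archimedean factor — on `Δ > 0`
the real locus has TWO components, `n_W = numRealComponents (W ⊗ ℝ) = 2`, so `Ω(W)·Ω(Wd) = 2·Ω(W_K/K)` and the `−1` of the
regulator is cancelled (pen's v4 evaluation: regulator `−1`, periods `+[Δ > 0]`, Tamagawa `+ord₂ C(Wd)`, torsion `0`).

* `bsdPeriod_mul_bsdPeriod_twin_eq_numRealComponents_mul` — sign-free: `Ω(W)·Ω(Wd) = n_W · Ω(W_K/K)` for `W/ℚ` globally minimal, `K`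
  imaginary quadratic with odd `d_K` + Heegner, `Wd` any globally minimal model of `W^{(d_K)}` (Milne 1972 §1 comparison + Pal 2012
  `ũ = 1`); `…_eq_two_mul` — the case `0 < Δ`;
* `genusIndexLawPos_of_rank_one` — `0 < Δ`, `rank_ℤ E(K) = 1`, `ρ_{E,2}` onto ⇒ `ρ = C(W)·C(Wd)·#E(K)_tors²/(C(W_K)·#E(ℚ)_tors²·#Wd(ℚ)_tors²)`,
  `ord₂ ρ = ord₂ C(Wd)` (UNCONDITIONAL);
* `stub_genusIndexLawPos_of_kolyvagin` — the LINE 19 v4.2 stub's statement after its by-name antecedent `PubInputsAtTwo`, VERBATIM,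
  behind `∀ N W K, kolyvagin N W K` (= the second conjunct of the pen's `PubInputsAtTwo`): closer
  `fun h => stub_genusIndexLawPos_of_kolyvagin h.2.1`.

References: [DokchitserDokchitserAnnals2010] Conj. 2.1; [Milne1972ArithmeticAV] §1; [Pal2012] Prop. 2.5, Thm. 3.2; [Kramer1981] Prop. 3,
Thm. 1; [GrossLMS1991] §1 (1.2), Thm. 1.3; [SilvermanAEC2009] Exercise 10.16, VIII.9; [CremonaAlgorithms1997] §3.7 (`n_W`).
-/

set_option autoImplicit false
-- the Theorems namespace of this sub repeats the summit name by design (D-0017 nested layout)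
set_option linter.dupNamespace false

noncomputable section

open scoped Classical

namespace Summit.BirchSwinnertonDyer.BirchSwinnertonDyer.Theorems.GenusExact.PlusDescent

open WeierstrassCurve NumberField Literature.NumberTheory.EllipticCurves
  Literature.NumberTheory.EllipticCurves.ModularForms

/-! ## (Ω) sign-free and on `Δ > 0` -/

section Period

variable (W : WeierstrassCurve ℚ) [W.IsElliptic] [W.IsGloballyMinimal] (K : Type) [Field K] [NumberField K]

/-- **`Ω(W) · Ω(Wd) = n_W · Ω(W_K/K)`** for `W/ℚ` globally minimal elliptic, `K` imaginary quadratic with odd `d_K` satisfying the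
Heegner hypothesis for `N_W`, and `Wd` any globally minimal model of `W^{(d_K)}`; `n_W ∈ {1, 2}` the number of real components.
(Milne 1972 §1 archimedean comparison `realPeriod_mul_realPeriod_quadraticTwist_eq_mul_bsdPeriod` + `Ω(Wd) = |u|·Ω(W^{(d_K)})`,
`u = ±1` by Pal 2012 Prop. 2.5.) UNCONDITIONAL. [cite: Milne1972ArithmeticAV, §1] [cite: Pal2012, Thm. 3.2 with Prop. 2.5] -/
theorem bsdPeriod_mul_bsdPeriod_twin_eq_numRealComponents_mul (hK : IsImaginaryQuadratic K)
    (hodd : Odd (NumberField.discr K)) (hH : SatisfiesHeegnerHypothesis (W.conductorNorm ℤ) K)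
    (Wd : WeierstrassCurve ℚ) [Wd.IsElliptic] [Wd.IsGloballyMinimal]
    (hWd : ∃ C : VariableChange ℚ, C • W.quadraticTwist (NumberField.discr K : ℚ) = Wd) :
    W.bsdPeriod * Wd.bsdPeriod = (W.baseChange ℝ).numRealComponents * (W.baseChange K).bsdPeriod := by
  obtain ⟨C, hC⟩ := hWd
  have h2 : Module.finrank ℚ K = 2 := hK.1
  haveI : IsTotallyComplex K := hK.2
  have hu : |((C.u : ℚ) : ℝ)| = 1 := by
    rcases u_eq_one_or_eq_neg_one_of_twin W K h2 hodd hH Wd C hC with h | h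
    · rw [h]; simp
    · rw [h]; simp
  have hΩd : Wd.bsdPeriod = ((W.quadraticTwist (NumberField.discr K : ℚ)).baseChange ℝ).realPeriod := by
    rw [bsdPeriod_eq_realPeriod_baseChange, ← WeierstrassCurve.realPeriodRat_def,
      ← WeierstrassCurve.realPeriodRat_def, ← hC,
      (W.quadraticTwist (NumberField.discr K : ℚ)).realPeriodRat_smul_holds C, hu, one_mul]
  rw [bsdPeriod_eq_realPeriod_baseChange, hΩd]
  exact W.realPeriod_mul_realPeriod_quadraticTwist_eq_mul_bsdPeriod K h2

/-- **The period product on `Δ > 0`: `Ω(W) · Ω(Wd) = 2 · Ω(W_K/K)`** (two real components, Cremona §3.7).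
[cite: Milne1972ArithmeticAV, §1] [cite: Pal2012, Thm. 3.2 with Prop. 2.5] [cite: CremonaAlgorithms1997, §3.7] -/
theorem bsdPeriod_mul_bsdPeriod_twin_eq_two_mul (hΔ : 0 < W.Δ) (hK : IsImaginaryQuadratic K)
    (hodd : Odd (NumberField.discr K)) (hH : SatisfiesHeegnerHypothesis (W.conductorNorm ℤ) K)
    (Wd : WeierstrassCurve ℚ) [Wd.IsElliptic] [Wd.IsGloballyMinimal]
    (hWd : ∃ C : VariableChange ℚ, C • W.quadraticTwist (NumberField.discr K : ℚ) = Wd) :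
    W.bsdPeriod * Wd.bsdPeriod = 2 * (W.baseChange K).bsdPeriod := by
  have hn : (W.baseChange ℝ).numRealComponents = 2 := by
    apply numRealComponents_of_Δ_pos
    rw [WeierstrassCurve.baseChange, map_Δ, eq_ratCast]
    exact_mod_cast hΔ
  have h := bsdPeriod_mul_bsdPeriod_twin_eq_numRealComponents_mul W K hK hodd hH Wd hWd
  rw [hn] at h
  exact_mod_cast h

end Period

/-! ## The law on `Δ > 0` -/

/-- **THE GENUS INDEX LAW ON `Δ > 0` with `rank E(K) = 1` as a hypothesis (UNCONDITIONAL).**  `W/ℚ` globally minimal elliptic with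
odd `∏ c_ℓ` and `0 < Δ`; `K` imaginary quadratic with odd `d_K` + Heegner; `ρ_{E,2}` onto; `rank_ℤ E(K) = 1`; `Wd` a globally minimal
model of `E^{(d_K)}`.  Then `ρ = B(W)·B(Wd)/B(W_K)` is the rational
`q = C(W)·C(Wd)·#E(K)_tors² / (C(W_K)·#E(ℚ)_tors²·#Wd(ℚ)_tors²) ≠ 0` with `ord₂ q = ord₂ C(Wd)` (regulator `1/2`, periods `2`, `C(W_K) = C(W)²`
odd, all torsion odd). [cite: DokchitserDokchitserAnnals2010, Conj. 2.1] [cite: Kramer1981, Prop. 3 and Thm. 1] [cite: Pal2012, Prop. 2.5]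
[cite: GrossLMS1991, §1 (1.2)] [cite: SilvermanAEC2009, Exercise 10.16 and VIII.9] -/
theorem genusIndexLawPos_of_rank_one (W : WeierstrassCurve ℚ) [W.IsElliptic] [W.IsGloballyMinimal]
    (hT : Odd W.tamagawaProduct) (hΔ : 0 < W.Δ) (K : Type) [Field K] [NumberField K]
    (hK : IsImaginaryQuadratic K) (hodd : Odd (NumberField.discr K))
    (hH : SatisfiesHeegnerHypothesis (W.conductorNorm ℤ) K) (hρ : W.HasSurjectiveModNGaloisRep 2)
    (hrank : (W.baseChange K).mordellWeilRank = 1)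
    (Wd : WeierstrassCurve ℚ) [Wd.IsElliptic] [Wd.IsGloballyMinimal]
    (hWd : ∃ C : WeierstrassCurve.VariableChange ℚ, C • W.quadraticTwist (NumberField.discr K : ℚ) = Wd) :
    ∃ q : ℚ, q ≠ 0 ∧ (q : ℝ) = (W.regulator * W.bsdPeriod * ((W.modifiedTamagawaProduct : ℚ) : ℝ) / ((W.torsionOrder : ℕ) : ℝ) ^ 2) * (Wd.regulator * Wd.bsdPeriod * ((Wd.modifiedTamagawaProduct : ℚ) : ℝ) / ((Wd.torsionOrder : ℕ) : ℝ) ^ 2) / ((W.baseChange K).regulator * (W.baseChange K).bsdPeriod * (((W.baseChange K).modifiedTamagawaProduct : ℚ) : ℝ) / (((W.baseChange K).torsionOrder : ℕ) : ℝ) ^ 2) ∧ padicValRat 2 q = (padicValNat 2 Wd.tamagawaProduct : ℤ) := by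
  -- pin the decidability instance on `ℚ` to the classical one carried by the generic-field lemmas
  letI hdec : DecidableEq ℚ := fun a b => Classical.propDecidable (a = b)
  obtain ⟨C, hC⟩ := hWd
  have h2 : Module.finrank ℚ K = 2 := hK.1
  haveI hEK : (W.baseChange K).IsElliptic := by rw [WeierstrassCurve.baseChange]; infer_instance
  have hd0 : (NumberField.discr K : ℚ) ≠ 0 := by exact_mod_cast NumberField.discr_ne_zero K
  haveI := W.isElliptic_quadraticTwist hd0
  -- (T) no `2`-torsion and odd torsion orders
  have htK : ∀ P : (W.baseChange K).toAffine.Point, 2 • P = 0 → P = 0 :=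
    forall_two_nsmul_baseChange_of_hasSurjectiveModNGaloisRep_two_of_isImaginaryQuadratic W hρ K hK
  have htWd : ∀ P : Wd.toAffine.Point, 2 • P = 0 → P = 0 := by
    intro P hP
    set e := (VariableChange.pointEquiv (W.quadraticTwist (NumberField.discr K : ℚ)) C).trans
      (Affine.Point.congrEquiv hC) with he
    have h := forall_two_nsmul_eq_zero_quadraticTwist_discr W K h2 htK (e.symm P)
      (by rw [← map_nsmul, hP, map_zero])
    simpa using congrArg e h
  have hoW : Odd W.torsionOrder := odd_torsionOrder_of_hasSurjectiveModNGaloisRep_two W hρ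
  have hoWd : Odd Wd.torsionOrder := odd_torsionOrder_of_forall_two_nsmul Wd htWd
  have hoK : Odd (W.baseChange K).torsionOrder :=
    odd_torsionOrder_baseChange_of_hasSurjectiveModNGaloisRep_two_of_isImaginaryQuadratic W hρ K hK
  -- (C) Tamagawa products on the three globally minimal models
  have hCK : (W.baseChange K).tamagawaProduct = W.tamagawaProduct ^ 2 :=
    tamagawaProduct_baseChange_eq_sq_of_heegner W K h2 hH
  have hoCK : Odd (W.baseChange K).tamagawaProduct := by rw [hCK]; exact hT.pow
  have hmW : W.modifiedTamagawaProduct = (W.tamagawaProduct : ℚ) :=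
    modifiedTamagawaProduct_eq_tamagawaProduct_of_isGloballyMinimal W
  have hmWd : Wd.modifiedTamagawaProduct = (Wd.tamagawaProduct : ℚ) :=
    modifiedTamagawaProduct_eq_tamagawaProduct_of_isGloballyMinimal Wd
  have hmK : (W.baseChange K).modifiedTamagawaProduct = ((W.baseChange K).tamagawaProduct : ℚ) :=
    modifiedTamagawaProduct_baseChange_eq_tamagawaProduct_of_isImaginaryQuadratic W hK hH
  -- (R) and (Ω)
  have hR : W.regulator * Wd.regulator = (W.baseChange K).regulator / 2 :=
    regulator_mul_regulator_eq_half_of_twist W K h2 hrank htK Wd hC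
  have hΩ : W.bsdPeriod * Wd.bsdPeriod = 2 * (W.baseChange K).bsdPeriod :=
    bsdPeriod_mul_bsdPeriod_twin_eq_two_mul W K hΔ hK hodd hH Wd ⟨C, hC⟩
  -- positivity
  have hRW : 0 < W.regulator := W.regulator_pos'
  have hRWd : 0 < Wd.regulator := Wd.regulator_pos'
  have hΩW : 0 < W.bsdPeriod := W.bsdPeriod_pos'
  have hΩWd : 0 < Wd.bsdPeriod := Wd.bsdPeriod_pos'
  have hΩK : 0 < (W.baseChange K).bsdPeriod := (W.baseChange K).bsdPeriod_pos'
  have hTW : 0 < W.torsionOrder := W.torsionOrder_pos_holds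
  have hTWd : 0 < Wd.torsionOrder := Wd.torsionOrder_pos_holds
  have hTK : 0 < (W.baseChange K).torsionOrder := (W.baseChange K).torsionOrder_pos_holds
  have hCW : 0 < W.tamagawaProduct := W.tamagawaProduct_pos_holds
  have hCWd : 0 < Wd.tamagawaProduct := Wd.tamagawaProduct_pos_holds
  have hCKpos : 0 < (W.baseChange K).tamagawaProduct := (W.baseChange K).tamagawaProduct_pos_holds
  -- the rational value
  set a : ℕ := W.tamagawaProduct * Wd.tamagawaProduct * (W.baseChange K).torsionOrder ^ 2 with ha
  set b : ℕ := (W.baseChange K).tamagawaProduct * W.torsionOrder ^ 2 * Wd.torsionOrder ^ 2 with hb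
  have ha0 : a ≠ 0 := by positivity
  have hb0 : b ≠ 0 := by positivity
  refine ⟨(a : ℚ) / (b : ℚ), div_ne_zero (by exact_mod_cast ha0) (by exact_mod_cast hb0), ?_, ?_⟩
  · -- the identity of real numbers
    have hRK' : (W.baseChange K).regulator = 2 * (W.regulator * Wd.regulator) := by rw [hR]; ring
    have hΩK' : (W.baseChange K).bsdPeriod = (W.bsdPeriod * Wd.bsdPeriod) / 2 := by rw [hΩ]; ring
    rw [hmW, hmWd, hmK, hRK', hΩK', ha, hb]
    push_cast
    have h1 : (W.torsionOrder : ℝ) ≠ 0 := by positivity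
    have h2' : (Wd.torsionOrder : ℝ) ≠ 0 := by positivity
    have h3 : ((W.baseChange K).torsionOrder : ℝ) ≠ 0 := by positivity
    have h4 : ((W.baseChange K).tamagawaProduct : ℝ) ≠ 0 := by positivity
    have h5 : W.regulator ≠ 0 := hRW.ne'
    have h6 : Wd.regulator ≠ 0 := hRWd.ne'
    have h7 : W.bsdPeriod ≠ 0 := hΩW.ne'
    have h8 : Wd.bsdPeriod ≠ 0 := hΩWd.ne'
    field_simp
  · -- the `2`-adic valuation
    haveI : Fact (Nat.Prime 2) := ⟨Nat.prime_two⟩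
    have hv : ∀ {n : ℕ}, Odd n → padicValNat 2 n = 0 := fun h =>
      padicValNat.eq_zero_of_not_dvd h.not_two_dvd_nat
    have n1 : W.tamagawaProduct ≠ 0 := hCW.ne'
    have n2 : Wd.tamagawaProduct ≠ 0 := hCWd.ne'
    have n3 : (W.baseChange K).torsionOrder ^ 2 ≠ 0 := pow_ne_zero _ hTK.ne'
    have n12 : W.tamagawaProduct * Wd.tamagawaProduct ≠ 0 := mul_ne_zero n1 n2
    have n5 : (W.baseChange K).tamagawaProduct ≠ 0 := hCKpos.ne'
    have n6 : W.torsionOrder ^ 2 ≠ 0 := pow_ne_zero _ hTW.ne'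
    have n7 : Wd.torsionOrder ^ 2 ≠ 0 := pow_ne_zero _ hTWd.ne'
    have n56 : (W.baseChange K).tamagawaProduct * W.torsionOrder ^ 2 ≠ 0 := mul_ne_zero n5 n6
    have haQ : (a : ℚ) ≠ 0 := by exact_mod_cast ha0
    have hbQ : (b : ℚ) ≠ 0 := by exact_mod_cast hb0
    rw [padicValRat.div haQ hbQ, padicValRat.of_nat, padicValRat.of_nat, ha, hb,
      padicValNat.mul n12 n3, padicValNat.mul n1 n2, padicValNat.mul n56 n7, padicValNat.mul n5 n6,
      padicValNat.pow, padicValNat.pow, padicValNat.pow, hv hT, hv hoK, hv hoCK, hv hoW, hv hoWd]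
    push_cast
    ring

/-- **LINE 19 v4.2 stub K `stub_genusIndexLaw` (L⁺_T `PowDvdShaCardAtTwoPosT`, stmt-23379) PROVED MODULO `kolyvagin`.**  The stub's
statement after its by-name antecedent `PubInputsAtTwo`, VERBATIM, behind the print fact `∀ N W K, kolyvagin N W K` (= the second
conjunct of `PubInputsAtTwo`; closer `fun h => stub_genusIndexLawPos_of_kolyvagin h.2.1`): `y_1 = P(1)` descends to a non-torsion
Heegner point in `E(K)`, Kolyvagin gives `rank_ℤ E(K) = 1`, `ρ_{E,2}` onto is `n = 1` of the tower binder, and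
`genusIndexLawPos_of_rank_one` concludes.  CONDITIONAL on the named fact `kolyvagin` (closes nothing).
[cite: GrossLMS1991, Thm. 1.3] [cite: DokchitserDokchitserAnnals2010, Conj. 2.1] [cite: Kramer1981, Prop. 3 and Thm. 1] [cite: Pal2012, Prop. 2.5] -/
theorem stub_genusIndexLawPos_of_kolyvagin
    (hKo : ∀ (N : ℕ) [NeZero N] (W : WeierstrassCurve ℚ) (K : Type) [Field K] [NumberField K],
      kolyvagin N W K) :
    ∀ (W : WeierstrassCurve ℚ) [W.IsElliptic] [W.IsGloballyMinimal] [NeZero (W.conductorNorm ℤ)], Odd W.tamagawaProduct → 0 < W.Δ → ∀ (K : Type) [Field K] [NumberField K], Literature.NumberTheory.EllipticCurves.IsImaginaryQuadratic K → Odd (NumberField.discr K) → NumberField.discr K ≠ -3 → Literature.NumberTheory.EllipticCurves.SatisfiesHeegnerHypothesis (W.conductorNorm ℤ) K → (∀ n : ℕ, 0 < n → W.HasSurjectiveModNGaloisRep ((2 : ℤ) ^ n)) → ∀ (Dt : Literature.NumberTheory.EllipticCurves.ModularForms.ModularParametrizationData W (W.conductorNorm ℤ)) (β : ℤ) (ι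 : K →+* ℂ) (d₁ : Literature.NumberTheory.EllipticCurves.KolyvaginHeegnerData Dt β ι 1), ¬ IsOfFinAddOrder d₁.derivedPoint → ∀ (Wd : WeierstrassCurve ℚ) [Wd.IsElliptic] [Wd.IsGloballyMinimal], (∃ C : WeierstrassCurve.VariableChange ℚ, C • W.quadraticTwist (NumberField.discr K : ℚ) = Wd) → ∃ q : ℚ, q ≠ 0 ∧ (q : ℝ) = (W.regulator * W.bsdPeriod * ((W.modifiedTamagawaProduct : ℚ) : ℝ) / ((W.torsionOrder : ℕ) : ℝ) ^ 2) * (Wd.regulator * Wd.bsdPeriod * ((Wd.modifiedTamagawaProduct : ℚ) : ℝ) / ((Wd.torsionOrder : ℕ) : ℝ) ^ 2) / ((W.baseChange K).regulator * (W.baseChange K).bsdPeriod * (((W.baseChange K).modifiedTamagawaProduct : ℚ) : ℝ) / (((W.baseChange K).torsionOrder : ℕ) : ℝ) ^ 2) ∧ padicValRat 2 q = (padicValNat 2 Wd.tamagawaProduct : ℤ) := by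
  intro W _ _ _ hT hΔ K _ _ hK hodd _ hH hρ Dt β ι d₁ hy Wd _ _ hWd
  haveI hEK : (W.baseChange K).IsElliptic := by rw [WeierstrassCurve.baseChange]; infer_instance
  obtain ⟨P₀, hP₀, hP₀K⟩ := heegnerSystem_exists_isHeegnerPoint_map_eq_derivedPoint_one
    (heegnerPointOfConductor_one_galoisConj_holds (W.conductorNorm ℤ) W K) hK hH d₁
  have hPinf : ¬ IsOfFinAddOrder P₀ := by
    intro hfin
    apply hy
    rw [← hP₀K]
    exact (WeierstrassCurve.Affine.Point.map (W' := W)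
      (algebraMap K (ringClassField K ι 1)).toRatAlgHom).isOfFinAddOrder hfin
  obtain ⟨hrank, -⟩ := hKo (W.conductorNorm ℤ) W K hK hH hP₀ hPinf
  have hρ2 : W.HasSurjectiveModNGaloisRep 2 := by simpa using hρ 1 one_pos
  exact genusIndexLawPos_of_rank_one W hT hΔ K hK hodd hH hρ2 hrank Wd hWd

end Summit.BirchSwinnertonDyer.BirchSwinnertonDyer.Theorems.GenusExact.PlusDescent

end
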